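import Literature.NumberTheory.Automorphic.SLTwoTreeTransitive              -- ★ B-p08 (g28) (W1c)-A part 4 p843742: `exists_glVertexAct_eq`, `mapGL_latt_one`, `exists_mem_glInt_coe_eq_diagonal`
import Literature.NumberTheory.Automorphic.SLTwoTreeProjectiveActionAdj     -- ★ B-p08 (g28) (W1c)-A part 2 p843636: `glVertexAct_coe_of_valuation_det_eq_one`, `valuation_det_coe_mul`
import Literature.NumberTheory.LocalFields.QuadraticOrderRegularRepShells   -- ★ p08 (g15) (W′3-alg) p843859: `regRep_mul`, `regRep_comm`, `det_regRep`, `diagonal_inv_mul_regRep_mul_diagonal'` (LL (2.1))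
import HarnessLib

/-!
# The non-split quadratic torus on the tree of `SL₂(F)`, I: the stabiliser test and the FIXED SHELLS (Labesse–Langlands 1979, §2 pp. 7–8)

Topic `NumberTheory/Automorphic`; namespace `Literature.NumberTheory.Automorphic.HermitianLatticeTree` (ROAD W's).  KERNEL mathematics only: theorems, no definition, no
named fact, no instance, no notation, no `sorry`.  Cell `pub/hodgecm-mathlib` (D-0151), crux H413 = `stmt-HodgeConjecture-24833`, line «N6nsGerm», the WILDLY RAMIFIED
residue «R1-CM-ram-wild» of books row #159 ∕ #165 (`RankOneUnstableTransferNonsplitCMERamifiedWild`, ★ def p843764) — opportunistic brick **«R1LL-WILD (W′1)» «THE TORUS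
IN THE TREE»** of A-p12 (g19)'s census `F0/P3a/A-p12/g19/CENSUS-R1LL-wild.A-p12g19.md` §2 (LEAD F0P3a-plan (g10) WORD T9-22 (4): zero architect time); seat A-p17 (g23),
census `A-provers/A-p17/g23/CENSUS-W1prime-TorusInTree.A-p17g23.md`.  Part II (same seat): `SLTwoTreeQuadraticTorusShellDecomposition` (every vertex lies in exactly one
shell).  Neighbours: (W′3)-ALG p08 (g15) `LocalFields/QuadraticOrderRegularRepShells` (same tokens, `Valued` currency), (W′2) B-p14 (g33) (weighted unfolding), (W′4) A-p12
(g19) ∕ A-p01 (g21) (deep shells cancel).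
HONEST LABEL: HC_CM is proved only modulo the cell's 2 remaining named inputs (hLiu418, h413) until rung 0 closes; nothing printed is asserted here — elementary lattice
algebra over a discrete valuation ring.

THE MATHEMATICS.  `F` is a field with `[ValuativeRel F]` whose valuation ring `𝒪 = 𝒪[F]` is a DVR with uniformizing element `ϖ`; `X = latticeTree (RingHom.id F) ϖ J`,
`J = (0 1; −1 0)`, is the tree of `SL₂(F)` (★ (W0) `isTree_latticeTree_id_altJ`), on whose vertices `GL₂(F)` acts through `PGL₂(F)` by ★ `glVertexAct hϖ` ((W1c)-A);
`v₀` is the root `𝒪²` (binder `hv₀ : v₀.1 = latt 1`).  A quadratic algebra `E = F[τ]`, `τ² = u τ + v` (`u v ∈ 𝒪` — an ABSTRACT integral basis `{1, τ}`: ONE statement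
for the unramified, the `√π`- and the dyadic `√u`-type alike), acts on `F² = F ⊕ F τ` by the REGULAR REPRESENTATION `γ = a + b τ ↦ (a, b v; b, a + b u)` [LL79 p. 7]; these
matrices commute pairwise (the torus `T ⊂ GL₂(F)`).  The SHELL-`m` REPRESENTATIVE is `g_m = diag(1, ϖ^m)`, `m : ℕ` (its lattice `𝒪 ⊕ ϖ^m 𝒪 τ` is the order of conductor
`ϖ^m`) [LL79 p. 8], and the shell-`m` vertices are the `t · g_m · v₀`, `t ∈ T`.
* (algebra of the torus matrices — products, commutation, `det = a² + abu − b²v`, LL (2.1) — is ★ p08 (g15)'s `QuadraticRegularRep.*`, imported.)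
* §1 `glVertexAct_glVertexAct_eq_iff_mem_glInt`: for `|det γ| = 1`, **`γ · (g · v₀) = g · v₀ ⟺ g⁻¹ γ g ∈ GL₂(𝒪)`** (Serre: `Stab 𝒪² = F^× GL₂(𝒪)`; a determinant-unit
  element cannot rescale; every vertex is a `g · v₀` by ★ `exists_glVertexAct_eq`).  (B-p08 (g28)'s `glVertexAct_eq_self_iff` is the `F^× · GL₂(𝒪)` form for arbitrary `γ`.)
* §2 THE CONJUGATE AT A SHELL: `g_m⁻¹ (a, bv; b, a+bu) g_m = (a, b v ϖ^m; b ϖ^{−m}, a + b u)` [LL79 (2.1)], integral iff `|b| ≤ |ϖ|^m` (`a b u v ∈ 𝒪`; `Valued`-currency twin: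
  p08 (g15)'s `forall_v_shellConj_le_one_iff`).
* §3 **FIXED SHELLS** `glVertexAct_torus_shell_eq_iff`: for `γ = (a, bv; b, a+bu)`, `a b ∈ 𝒪`, `|det γ| = 1` (a unit of `𝒪 ⊕ 𝒪τ`) and ANY torus element `t`:
  **`γ · (t g_m · v₀) = t g_m · v₀ ⟺ |b| ≤ |ϖ|^m`** — `γ` fixes the WHOLE shell `m` when `m ≤ ord b` and NO vertex of it otherwise («`Fix(γ)` = the ball of radius
  `ord b` about the facet of `T`»; LL79 p. 8 «it is clear that `m` is uniquely determined»); `glVertexAct_torus_root_eq` (shell `0` is fixed pointwise by the units).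
NOT here: the shell decomposition and the uniqueness of `m` (part II); the class of `γ` at a fixed vertex modulo a level ((W′3)-ALG); the weighted unfolding ((W′2)); the
transport to the torus as it arrives through `ρ : U(Φ₂)(E_w) → PGL₂(F_v)` (★ `UnitaryTwoTreeActionDescent`: any embedded `E^×` is `GL₂(F)`-conjugate to the regular
representation — one `glVertexAct_mul` line for the (W′6) assembler).

## References
* [LabesseLanglands1979] J.-P. Labesse, R. P. Langlands, *L-indistinguishability for SL(2)*, Canad. J. Math. 31 (1979), §2 pp. 7–8 (the regular representation
  `(a, bv; b, a+bu)`, the double cosets `T(F)∖G(F)∕G(𝒪_F)` with representatives `diag(1, ϖ^m)`, formula (2.1)).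
* [Serre1980Trees] J.-P. Serre, *Trees* (1980), Ch. II §1.1 Theorem 1, §1.2–§1.3 (the tree of `SL₂` over a local field; stabilisers; `GL₂` acts through `PGL₂`).
* [BruhatTits1972] F. Bruhat, J. Tits, *Groupes réductifs sur un corps local I*, Publ. IHÉS 41 (1972), §10.
-/

set_option autoImplicit false

noncomputable section

open scoped ValuativeRel Matrix MatrixGroups
open Matrix ValuativeRel

namespace Literature.NumberTheory.Automorphic.HermitianLatticeTree

open Literature.NumberTheory.Automorphic Literature.NumberTheory.LocalFields

variable {F : Type*} [Field F] [ValuativeRel F] {ϖ : F} (hϖ : IsUniformizingElement ϖ) [IsDiscreteValuationRing 𝒪[F]]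

/-! ## §1 The stabiliser test at `g · v₀` for determinant-unit elements -/

include hϖ in
/-- For `g ∈ GL₂(F)`, the vertex `g · v₀` is the special lattice `ϖ^k · latt g` for some `k`. [cite: Serre1980Trees, Ch. II §1.1 Theorem 1] -/
theorem exists_coe_glVertexAct_root_eq (g : GL (Fin 2) F)
    (v₀ : {M : Submodule 𝒪[F] (Fin 2 → F) // IsSpecialLattice (RingHom.id F) ϖ !![(0 : F), 1; -1, 0] M})
    (hv₀ : v₀.1 = latt (1 : Matrix (Fin 2) (Fin 2) F)) :
    ∃ k : ℤ, (glVertexAct hϖ g v₀).1 = scaleLattice (ϖ ^ k) (latt (g : Matrix (Fin 2) (Fin 2) F)) := by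
  obtain ⟨k, hk⟩ := (glVertexAct_eq_iff hϖ g v₀ _).1 rfl
  exact ⟨k, by rw [hk, hv₀, mapGL_latt_one]⟩

include hϖ in
/-- **THE STABILISER TEST AT `g · v₀` FOR A DETERMINANT-UNIT ELEMENT** (Serre: `Stab(𝒪²) = F^× · GL₂(𝒪)`; a `γ` with `|det γ| = 1` cannot rescale): if `|det γ| = 1` then
`γ · (g · v₀) = g · v₀ ⟺ g⁻¹ γ g ∈ GL₂(𝒪)`.  Every vertex is a `g · v₀` (★ `exists_glVertexAct_eq`), so this is the general fixed-vertex criterion for the elements of a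
compact torus. [cite: Serre1980Trees, Ch. II §1.3] [cite: LabesseLanglands1979, §2 p. 8] -/
theorem glVertexAct_glVertexAct_eq_iff_mem_glInt (g γ : GL (Fin 2) F) (hγ : valuation F (γ : Matrix (Fin 2) (Fin 2) F).det = 1)
    (v₀ : {M : Submodule 𝒪[F] (Fin 2 → F) // IsSpecialLattice (RingHom.id F) ϖ !![(0 : F), 1; -1, 0] M})
    (hv₀ : v₀.1 = latt (1 : Matrix (Fin 2) (Fin 2) F)) :
    glVertexAct hϖ γ (glVertexAct hϖ g v₀) = glVertexAct hϖ g v₀ ↔ g⁻¹ * γ * g ∈ glInt 2 F := by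
  have h0 := hϖ.ne_zero
  obtain ⟨k₀, hk₀⟩ := exists_coe_glVertexAct_root_eq hϖ g v₀ hv₀
  rw [glVertexAct_eq_iff]
  constructor
  · rintro ⟨k, hk⟩
    -- `ϖ^{k₀} latt g = ϖ^k γ (ϖ^{k₀} latt g)`, i.e. `latt g = ϖ^k latt (γ g)`
    rw [hk₀, mapGL_scaleLattice, mapGL_latt, scaleLattice_scaleLattice, mul_comm, ← scaleLattice_scaleLattice] at hk
    have hk' : latt (g : Matrix (Fin 2) (Fin 2) F) = scaleLattice (ϖ ^ k) (latt ((γ * g : GL (Fin 2) F) : Matrix (Fin 2) (Fin 2) F)) := by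
      have hinj := (scaleLattice_le_scaleLattice_iff (zpow_ne_zero k₀ h0) (latt (g : Matrix (Fin 2) (Fin 2) F))
        (scaleLattice (ϖ ^ k) (latt ((γ * g : GL (Fin 2) F) : Matrix (Fin 2) (Fin 2) F))))
      have hinj' := (scaleLattice_le_scaleLattice_iff (zpow_ne_zero k₀ h0)
        (scaleLattice (ϖ ^ k) (latt ((γ * g : GL (Fin 2) F) : Matrix (Fin 2) (Fin 2) F))) (latt (g : Matrix (Fin 2) (Fin 2) F)))
      exact le_antisymm (hinj.1 hk.le) (hinj'.1 hk.ge)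
    -- the scalar `ϖ^k` as an element of `GL₂(F)`
    set cm : Fˣ := (Units.mk0 ϖ h0) ^ k with hcm
    have hcmcoe : ((cm.map ((Matrix.scalar (Fin 2) : F →+* Matrix (Fin 2) (Fin 2) F) : F →* Matrix (Fin 2) (Fin 2) F) : GL (Fin 2) F) : Matrix (Fin 2) (Fin 2) F) =
        ϖ ^ k • (1 : Matrix (Fin 2) (Fin 2) F) := by
      rw [Units.coe_map, MonoidHom.coe_coe, Matrix.scalar_apply, ← Matrix.smul_one_eq_diagonal, hcm, Units.val_zpow_eq_zpow_val, Units.val_mk0]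
    have hcmval : (((cm.map ((Matrix.scalar (Fin 2) : F →+* Matrix (Fin 2) (Fin 2) F) : F →* Matrix (Fin 2) (Fin 2) F)) * (γ * g) : GL (Fin 2) F) :
        Matrix (Fin 2) (Fin 2) F) = ϖ ^ k • ((γ * g : GL (Fin 2) F) : Matrix (Fin 2) (Fin 2) F) := by
      rw [Units.val_mul, hcmcoe, Matrix.smul_mul, Matrix.one_mul]
    rw [scaleLattice_latt, ← hcmval] at hk'
    have hmem := (span_range_transpose_eq_iff g _).1 hk'
    -- determinant: `|ϖ^{2k} det γ| = 1` forces `k = 0`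
    have hdet := valuation_det_eq_one_of_mem_glInt hmem
    rw [Units.val_mul, Matrix.det_mul, hcmval, Matrix.det_smul, Fintype.card_fin, Units.val_mul, Matrix.det_mul, map_mul, map_mul, map_mul, map_pow,
      map_zpow₀, hγ, one_mul, Matrix.coe_units_inv, Matrix.det_nonsing_inv, Ring.inverse_eq_inv', map_inv₀, ← zpow_natCast, ← _root_.zpow_mul,
      mul_comm, mul_assoc, mul_inv_cancel₀ ((Valuation.ne_zero_iff _).2 (g.isUnit.map Matrix.detMonoidHom).ne_zero), mul_one] at hdet
    have hk0 : k = 0 := by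
      have := (valuation_zpow_eq_one_iff hϖ _).1 hdet
      omega
    rw [hk0, zpow_zero] at hcm
    have hcm1 : cm = 1 := by rw [hcm]
    rw [hcm1, map_one, one_mul, ← mul_assoc] at hmem
    exact hmem
  · intro hmem
    refine ⟨0, ?_⟩
    rw [zpow_zero, scaleLattice_one, hk₀, mapGL_scaleLattice, mapGL_latt]
    congr 1
    rw [show γ * g = g * (g⁻¹ * γ * g) by rw [mul_assoc, mul_inv_cancel_left], latt_mul_of_mem_glInt g _ hmem]

/-! ## §2 The conjugate of a torus element at the shell-`m` representative `diag(1, ϖ^m)` (LL79 (2.1)) -/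

omit [ValuativeRel F] [IsDiscreteValuationRing 𝒪[F]] in
/-- The inverse of `diag(1, c) ∈ GL₂(F)` is `diag(1, c⁻¹)`. [cite: LabesseLanglands1979, §2 p. 8] -/
theorem coe_inv_of_coe_eq_diagonal_one {g : GL (Fin 2) F} {c : F} (hg : (g : Matrix (Fin 2) (Fin 2) F) = Matrix.diagonal ![1, c]) (hc : c ≠ 0) :
    ((g⁻¹ : GL (Fin 2) F) : Matrix (Fin 2) (Fin 2) F) = Matrix.diagonal ![1, c⁻¹] := by
  rw [Matrix.coe_units_inv, hg]
  refine Matrix.inv_eq_left_inv ?_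
  rw [Matrix.diagonal_mul_diagonal, ← Matrix.diagonal_one]
  congr 1
  funext i
  fin_cases i
  · simp
  · simp [hc]

omit [ValuativeRel F] [IsDiscreteValuationRing 𝒪[F]] in
/-- The shell conjugate inside `GL₂(F)`: for `↑γ = (a, bv; b, a+bu)` and `↑g = diag(1, c)`, `↑(g⁻¹ γ g) = (a, b v c; b c⁻¹, a + b u)`. [cite: LabesseLanglands1979, §2 (2.1) p. 8] -/
theorem coe_inv_mul_torus_mul_of_coe_eq_diagonal (u v a b : F) {γ g : GL (Fin 2) F} {c : F} (hγ : (γ : Matrix (Fin 2) (Fin 2) F) = !![a, b * v; b, a + b * u])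
    (hg : (g : Matrix (Fin 2) (Fin 2) F) = Matrix.diagonal ![1, c]) (hc : c ≠ 0) :
    ((g⁻¹ * γ * g : GL (Fin 2) F) : Matrix (Fin 2) (Fin 2) F) = !![a, b * v * c; b * c⁻¹, a + b * u] := by
  rw [Units.val_mul, Units.val_mul, coe_inv_of_coe_eq_diagonal_one hg hc, hγ, hg, QuadraticRegularRep.diagonal_inv_mul_regRep_mul_diagonal' u v c hc a b]

omit [IsDiscreteValuationRing 𝒪[F]] in
/-- **INTEGRALITY OF THE SHELL CONJUGATE** (LL79 p. 8: «it is clear that `m` is uniquely determined»): for `a b u v ∈ 𝒪` and `c ∈ 𝒪 ∖ {0}`, ALL entries of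
`(a, b v c; b c⁻¹, a + b u)` are integral iff `|b| ≤ |c|` — «`a + bτ` maps the lattice `𝒪 ⊕ c 𝒪 τ` into itself iff `b ∈ c𝒪`».  (`Valued`-currency twin: p08 (g15)'s
`QuadraticRegularRep.forall_v_shellConj_le_one_iff`.) [cite: LabesseLanglands1979, §2 p. 8] -/
theorem isIntegralMatrix_shellConj_iff {u v a b c : F} (hu : u ∈ 𝒪[F]) (hv : v ∈ 𝒪[F]) (ha : a ∈ 𝒪[F]) (hb : b ∈ 𝒪[F]) (hcO : c ∈ 𝒪[F]) (hc : c ≠ 0) :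
    IsIntegralMatrix (!![a, b * v * c; b * c⁻¹, a + b * u]) ↔ valuation F b ≤ valuation F c := by
  have hvc : valuation F c ≠ 0 := (Valuation.ne_zero_iff _).2 hc
  have hkey : b * c⁻¹ ∈ 𝒪[F] ↔ valuation F b ≤ valuation F c := by
    rw [Valuation.mem_integer_iff, map_mul, map_inv₀, mul_inv_le_iff₀ (zero_lt_iff.2 hvc), one_mul]
  constructor
  · intro h
    exact hkey.1 (by simpa using h 1 0)
  · intro h i j
    fin_cases i <;> fin_cases j
    · simpa using ha
    · show b * v * c ∈ 𝒪[F]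
      exact mul_mem (mul_mem hb hv) hcO
    · simpa using hkey.2 h
    · show a + b * u ∈ 𝒪[F]
      exact add_mem ha (mul_mem hb hu)

/-! ## §3 FIXED SHELLS: `γ = a + bτ` fixes the shell `m` iff `|b| ≤ |ϖ|^m` -/

omit [ValuativeRel F] [IsDiscreteValuationRing 𝒪[F]] in
/-- Two torus elements of `GL₂(F)` commute. [cite: LabesseLanglands1979, §2 p. 7] -/
theorem quadTorus_mul_comm {u v a b c d : F} {γ t : GL (Fin 2) F} (hγ : (γ : Matrix (Fin 2) (Fin 2) F) = !![a, b * v; b, a + b * u])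
    (ht : (t : Matrix (Fin 2) (Fin 2) F) = !![c, d * v; d, c + d * u]) : γ * t = t * γ := by
  ext : 1
  rw [Units.val_mul, Units.val_mul, hγ, ht, QuadraticRegularRep.regRep_comm]

omit [ValuativeRel F] [IsDiscreteValuationRing 𝒪[F]] in
/-- Conjugating a torus element by a torus element does nothing: `t⁻¹ γ t = γ`. [cite: LabesseLanglands1979, §2 p. 7] -/
theorem quadTorus_inv_mul_mul_eq {u v a b c d : F} {γ t : GL (Fin 2) F} (hγ : (γ : Matrix (Fin 2) (Fin 2) F) = !![a, b * v; b, a + b * u])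
    (ht : (t : Matrix (Fin 2) (Fin 2) F) = !![c, d * v; d, c + d * u]) : t⁻¹ * γ * t = γ := by
  rw [mul_assoc, quadTorus_mul_comm hγ ht, inv_mul_cancel_left]

include hϖ in
/-- **FIXED SHELLS** (LL79 p. 8; «`Fix(γ)` is a ball about the facet of the torus»): let `γ = (a, bv; b, a+bu)` with `a, b, u, v ∈ 𝒪` and `|det γ| = 1` (a UNIT of the order
`𝒪 ⊕ 𝒪τ`), let `t` be ANY torus element and `g_m = diag(1, ϖ^m)`.  Then `γ` fixes the shell-`m` vertex `t g_m · v₀` iff `|b| ≤ |ϖ|^m`: **the torus element fixes the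
WHOLE shell `m` when `m ≤ ord b`, and NO vertex of it otherwise.**  Proof: §1 at `g = t g_m`, `(t g_m)⁻¹ γ (t g_m) = g_m⁻¹ γ g_m` (the torus is abelian) = LL (2.1)'s matrix,
whose determinant `det γ` is a unit, so `GL₂(𝒪)`-membership is integrality of its four entries (§2). [cite: LabesseLanglands1979, §2 (2.1) p. 8] [cite: Serre1980Trees, Ch. II §1.3] -/
theorem glVertexAct_torus_shell_eq_iff {u v a b c d : F} (hu : u ∈ 𝒪[F]) (hv : v ∈ 𝒪[F]) (ha : a ∈ 𝒪[F]) (hb : b ∈ 𝒪[F])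
    {γ t gm : GL (Fin 2) F} (hγ : (γ : Matrix (Fin 2) (Fin 2) F) = !![a, b * v; b, a + b * u]) (hγdet : valuation F (γ : Matrix (Fin 2) (Fin 2) F).det = 1)
    (ht : (t : Matrix (Fin 2) (Fin 2) F) = !![c, d * v; d, c + d * u]) {m : ℕ} (hgm : (gm : Matrix (Fin 2) (Fin 2) F) = Matrix.diagonal ![1, ϖ ^ m])
    (v₀ : {M : Submodule 𝒪[F] (Fin 2 → F) // IsSpecialLattice (RingHom.id F) ϖ !![(0 : F), 1; -1, 0] M})
    (hv₀ : v₀.1 = latt (1 : Matrix (Fin 2) (Fin 2) F)) :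
    glVertexAct hϖ γ (glVertexAct hϖ (t * gm) v₀) = glVertexAct hϖ (t * gm) v₀ ↔ valuation F b ≤ valuation F ϖ ^ m := by
  have h0 := hϖ.ne_zero
  have hϖm : ϖ ^ m ≠ 0 := pow_ne_zero m h0
  rw [glVertexAct_glVertexAct_eq_iff_mem_glInt hϖ (t * gm) γ hγdet v₀ hv₀, _root_.mul_inv_rev, show gm⁻¹ * t⁻¹ * γ * (t * gm) = gm⁻¹ * (t⁻¹ * γ * t) * gm by
    simp only [mul_assoc], quadTorus_inv_mul_mul_eq hγ ht, ← map_pow]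
  have hcoe := coe_inv_mul_torus_mul_of_coe_eq_diagonal u v a b hγ hgm hϖm
  have hdet : valuation F (((gm⁻¹ * γ * gm : GL (Fin 2) F)) : Matrix (Fin 2) (Fin 2) F).det = 1 := by
    rw [Units.val_mul, Units.val_mul, Matrix.det_mul, Matrix.det_mul, mul_comm (((gm⁻¹ : GL (Fin 2) F) : Matrix (Fin 2) (Fin 2) F).det), mul_assoc, ← Matrix.det_mul,
      ← Units.val_mul, inv_mul_cancel, Units.val_one, Matrix.det_one, mul_one, hγdet]
  rw [← isIntegralMatrix_shellConj_iff hu hv ha hb (hϖ.pow_mem m) hϖm, ← hcoe]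
  exact ⟨isIntegralMatrix_of_mem_glInt, fun h => mem_glInt_of_isIntegralMatrix h hdet⟩

include hϖ in
/-- **SHELL `0`**: a unit `γ = a + bτ` of the order `𝒪 ⊕ 𝒪τ` (`a b u v ∈ 𝒪`, `|det γ| = 1`) fixes EVERY vertex `t · v₀` of the torus orbit of the root — the torus's own
facet is fixed pointwise by its compact part. [cite: LabesseLanglands1979, §2 p. 8] [cite: Serre1980Trees, Ch. II §1.3] -/
theorem glVertexAct_torus_root_eq {u v a b c d : F} (hu : u ∈ 𝒪[F]) (hv : v ∈ 𝒪[F]) (ha : a ∈ 𝒪[F]) (hb : b ∈ 𝒪[F])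
    {γ t : GL (Fin 2) F} (hγ : (γ : Matrix (Fin 2) (Fin 2) F) = !![a, b * v; b, a + b * u]) (hγdet : valuation F (γ : Matrix (Fin 2) (Fin 2) F).det = 1)
    (ht : (t : Matrix (Fin 2) (Fin 2) F) = !![c, d * v; d, c + d * u])
    (v₀ : {M : Submodule 𝒪[F] (Fin 2 → F) // IsSpecialLattice (RingHom.id F) ϖ !![(0 : F), 1; -1, 0] M})
    (hv₀ : v₀.1 = latt (1 : Matrix (Fin 2) (Fin 2) F)) :
    glVertexAct hϖ γ (glVertexAct hϖ t v₀) = glVertexAct hϖ t v₀ := by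
  have h1 : ((1 : GL (Fin 2) F) : Matrix (Fin 2) (Fin 2) F) = Matrix.diagonal ![1, ϖ ^ 0] := by
    rw [Units.val_one, pow_zero, ← Matrix.diagonal_one]
    congr 1
    funext i
    fin_cases i <;> rfl
  have h := (glVertexAct_torus_shell_eq_iff hϖ hu hv ha hb hγ hγdet ht h1 v₀ hv₀).2 (by rw [pow_zero]; exact (Valuation.mem_integer_iff _ _).1 hb)
  rwa [mul_one] at h

end Literature.NumberTheory.Automorphic.HermitianLatticeTree

end
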